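import Mathlib.AlgebraicGeometry.EllipticCurve.Affine.Point
import Mathlib.FieldTheory.Galois.Basic
import HarnessLib

/-!
# Galois descent for points of a Weierstrass curve: a point of `W(E)` fixed by `Gal(E/F)` comes from `W(F)`

For a Galois extension `E/k` (finite), an intermediate field `F`, a Weierstrass curve `W/k` and a point
`P ∈ W(E)` fixed by every `σ ∈ Gal(E/k)` fixing `F` pointwise, `P` is the image of a point of `W(F)`:
its coordinates lie in the fixed field of `F.fixingSubgroup`, which is `F` (`IsGalois.fixedField_fixingSubgroup`),
and nonsingularity descends along the injective embedding `F → E` (`baseChange_nonsingular`).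

This is the elementary step "a point rational over `E` and invariant under `Gal(E/F)` is rational over `F`"
used throughout the Heegner-point literature (e.g. Monsky 1990, proofs of Thms. 4.5 / 4.7: "`2S_N` is rational
over `ℚ(i√N)`"; Tian 2014, proof of Prop. 4.6: "`2y_m` is rational over `K(i,√−m) ∩ H = K(√−m)`"). Cell
`bsd-monsky` (typer seat): the first building block of the kernel target K1 (`HOME/lean/PLAN.md` tier 2).
Pure Mathlib; nothing asserted.

[cite: SilvermanAEC2009, §II.2 (Galois action on points) and §VIII.1] [folklore]
-/

noncomputable section

open scoped Classical

namespace WeierstrassCurve.Affine.Point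

variable {k E : Type*} [Field k] [Field E] [Algebra k E] [FiniteDimensional k E] [IsGalois k E]
  (W : WeierstrassCurve k) (F : IntermediateField k E)

/-- **Galois descent for points.** If `P ∈ W(E)` satisfies `σ(P) = P` for every `σ ∈ Gal(E/k)` fixing the
intermediate field `F` pointwise, then `P` is the image of a point of `W(F)` under the base change along
`F ↪ E`. [cite: SilvermanAEC2009, §II.2] [folklore] -/
theorem exists_map_eq_of_forall_fixingSubgroup (P : (W.baseChange E).toAffine.Point)
    (hP : ∀ σ : E ≃ₐ[k] E, σ ∈ F.fixingSubgroup →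
      WeierstrassCurve.Affine.Point.map (W' := W) σ.toAlgHom P = P) :
    ∃ Q : (W.baseChange F).toAffine.Point,
      WeierstrassCurve.Affine.Point.map (W' := W) (IsScalarTower.toAlgHom k F E) Q = P := by
  rcases P with _ | ⟨x, y, h⟩
  · exact ⟨0, rfl⟩
  · have hfix : ∀ σ : E ≃ₐ[k] E, σ ∈ F.fixingSubgroup → σ x = x ∧ σ y = y := by
      intro σ hσ
      have := hP σ hσ
      rw [WeierstrassCurve.Affine.Point.map_some] at this
      exact WeierstrassCurve.Affine.Point.some.inj this
    have hx : x ∈ F := by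
      rw [← IsGalois.fixedField_fixingSubgroup F, IntermediateField.mem_fixedField_iff]
      exact fun σ hσ => (hfix σ hσ).1
    have hy : y ∈ F := by
      rw [← IsGalois.fixedField_fixingSubgroup F, IntermediateField.mem_fixedField_iff]
      exact fun σ hσ => (hfix σ hσ).2
    have hinj : Function.Injective (IsScalarTower.toAlgHom k F E) := (IsScalarTower.toAlgHom k F E).injective
    have h' : (W.baseChange F).toAffine.Nonsingular (⟨x, hx⟩ : F) (⟨y, hy⟩ : F) :=
      (WeierstrassCurve.Affine.baseChange_nonsingular (W := W) (f := IsScalarTower.toAlgHom k F E)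
        hinj _ _).mp h
    refine ⟨.some (x := ⟨x, hx⟩) (y := ⟨y, hy⟩) h', ?_⟩
    rw [WeierstrassCurve.Affine.Point.map_some]
    rfl

end WeierstrassCurve.Affine.Point

end
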